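/-
Copyright: rh-split cell, seat prover-l1-w2 (L1 «DUST WALL», width seat 2), 2026-08-27.  Splitting search
over kernel-typed RH-equivalences; a splitting `A ∧ B ⟹ RH` is conditional bookkeeping unless `A` and
`B` are both proved.  Nothing here bears on the truth of RH.
-/
import Summits.RiemannHypothesis.RiemannHypothesis.Theorems.Splittings.ScrewDustCycleRow
import Summits.RiemannHypothesis.RiemannHypothesis.Theorems.Splittings.ScrewDustZorettiHull
import Summits.RiemannHypothesis.RiemannHypothesis.Theorems.Splittings.ScrewDustTotallyDisconnected
import HarnessLib

/-!
# The dust wall sits in the cycle row: `TD(h) ⟹ CENC(h)` for every step `h`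

Route `ScrewDustWall` (X-11 «DUST WALL») attacks the conjunct `TD(1)`: the wall
`T_1 = closure (aliasedPoleSet 1)` meets `𝔻` in a totally disconnected set.  Here the dust wall is
placed in the cycle row of `ScrewDustCycleRow` at every step `h`:

* `cycleEncirclable_of_pointComponent` (§1): if SOME aliased far zero `p` is a point-component of
  `T_h ∩ 𝔻` adherent to the origin's component `Ω₀(h)`, then `CENC(h)` — prover-l1's ZORETTI HULL
  (`ScrewDust.exists_small_cellComplex`: a wall-free grid cycle of `Ω₀(h)` around `p` inside
  `ball p (1 - ‖p‖) ⊆ 𝔻`, grid lines off the countable set of aliased zeros);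
* `cycleEncirclable_of_isTotallyDisconnected` (§1): `TD(h) ⟹ CENC(h)` (`h ≥ 0`) — under `TD(h)` every
  aliased far zero is such a point-component (prover-l1-w3's `connectedComponentIn_subset_singleton`,
  `mem_closure_ball_diff_wall_of_isTotallyDisconnected`, and item 21692's non-separation theorem
  `isPreconnected_ball_diff_of_isTotallyDisconnected`, which makes `𝔻 ∖ T_h ⊆ Ω₀(h)`);
* §2: `not_pointComponent_adherent_of_latticeCeiling` — the ζ-side reading of the crux: under
  `CEIL(h)` no aliased far zero is a point-component of `T_h ∩ 𝔻` adherent to `Ω₀(h)` (through the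
  cycle row, i.e. by Gauss's law for grid cycles with ONE cycle and no Tannery limit).

The dust row itself, `CEIL(h) ∧ TD(h) ⟺ RH` for every `h > 0`, is prover-l1-w3's
`ScrewDust.latticeCeiling_and_isTotallyDisconnected_iff_rh` (`ScrewDustWallRow`, via the crux); with
`cycleEncirclable_of_isTotallyDisconnected` it is ALSO a corollary of the cycle row
`latticeCeiling_and_cycleEncirclable_iff_rh`, so the family reads
`X-9 ⊆ X-10 ⊆ X-13′ ⊆ X-14 ⊆ X-CENC ⊇ X-11 ⊇ X-10`: the circle rows and the dust row have a common head,
the cycle row.  RH is not proved by any of this: every row is a CONDITIONAL splitting whose zero-side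
conjunct and residual `CEIL` stay open.

No `sorry`, no new axioms, no definitions, no instances, no notation.
-/

set_option linter.dupNamespace false

namespace Summit.RiemannHypothesis.RiemannHypothesis.Theorems.Splittings.ScrewLatticeCycleGauss

open Complex Filter Topology Set Metric
open Literature.NumberTheory.LFunctions
open Summit.RiemannHypothesis.RiemannHypothesis.Theorems.Splittings
open Summit.RiemannHypothesis.RiemannHypothesis.Theorems.Splittings.ScrewBorel
open Summit.RiemannHypothesis.RiemannHypothesis.Theorems.Splittings.ScrewLatticeContinuation
open Summit.RiemannHypothesis.RiemannHypothesis.Theorems.Splittings.ScrewLatticeThinWall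
open Summit.RiemannHypothesis.RiemannHypothesis.Theorems.Splittings.ScrewLatticeGauss
open Summit.RiemannHypothesis.RiemannHypothesis.Theorems.Splittings.ScrewDust

/-! ## 1. Point-components of the wall adherent to `Ω₀(h)` are cycle-encirclable -/

/-- The origin is off the wall `T_h` (`h ≥ 0`). -/
theorem zero_not_mem_wall {h : ℝ} (hh : 0 ≤ h) : (0 : ℂ) ∉ closure (aliasedPoleSet h) :=
  (originComponent_subset h (zero_mem_originComponent hh)).2

/-- **A point-component far zero adherent to `Ω₀(h)` is cycle-encirclable** (`h ≥ 0`): if an aliased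
far zero `p` is a point-component of `T_h ∩ 𝔻` and is adherent to the origin's component `Ω₀(h)` of
`𝔻 ∖ T_h`, then some wall-free grid cycle of `Ω₀(h)` encloses it (prover-l1's Zoretti hull). -/
theorem cycleEncirclable_of_pointComponent {h : ℝ} (hh : 0 ≤ h) {p : ℂ} (hp : p ∈ aliasedPoleSet h)
    (hcomp : connectedComponentIn (closure (aliasedPoleSet h) ∩ ball (0 : ℂ) 1) p ⊆ {p})
    (hadh : p ∈ closure (originComponent h)) : CycleEncirclable h := by
  intro _
  have hp1 : ‖p‖ < 1 := hp.1
  have hpT : p ∈ {q : ℂ | ∃ ρ : ZetaZeros.riemannZetaNontrivialZeros,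
      q = mult h ρ ∨ q = (mult h ρ)⁻¹} := hp.2
  obtain ⟨x, y, H, hx, hy, ⟨k, hk, hpk⟩, hH, hgp, hbot, htop, hlef, hrig⟩ :=
    exists_small_cellComplex isClosed_closure (zero_not_mem_wall hh) (countable_mults h)
      (subset_closure hp) hp1 hpT hcomp hadh (ε := 1 - ‖p‖) (by linarith)
  have hball : ball p (1 - ‖p‖) ⊆ ball (0 : ℂ) 1 :=
    ball_subset_ball' (by rw [dist_zero_right]; linarith)
  exact ⟨x, y, H, hx, hy, fun k hk ↦ (hH k hk).trans hball, fun ρ k hk q hq ↦ hgp q ⟨ρ, hq⟩ k hk,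
    hbot, htop, hlef, hrig, p, hp, k, hk, hpk⟩

/-- Under `TD(h)` the regular set `𝔻 ∖ T_h` IS the origin's component (`h ≥ 0`; item 21692). -/
theorem ball_diff_wall_subset_originComponent {h : ℝ} (hh : 0 ≤ h)
    (htd : IsTotallyDisconnected (closure (aliasedPoleSet h) ∩ ball (0 : ℂ) 1)) :
    ball (0 : ℂ) 1 \ closure (aliasedPoleSet h) ⊆ originComponent h :=
  subset_originComponent (isPreconnected_ball_diff_wall_of_isTotallyDisconnected htd)
    ⟨mem_ball_self one_pos, zero_not_mem_wall hh⟩ Subset.rfl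

/-- **`TD(h) ⟹ CENC(h)`** (`h ≥ 0`): a dust wall lets a wall-free grid cycle of `Ω₀(h)` around every
aliased far zero — the dust row X-11 sits in the cycle row. -/
theorem cycleEncirclable_of_isTotallyDisconnected {h : ℝ} (hh : 0 ≤ h)
    (htd : IsTotallyDisconnected (closure (aliasedPoleSet h) ∩ ball (0 : ℂ) 1)) :
    CycleEncirclable h := by
  intro hne
  obtain ⟨p, hp⟩ := hne
  refine cycleEncirclable_of_pointComponent hh hp (connectedComponentIn_subset_singleton htd p) ?_
    ⟨p, hp⟩
  exact closure_mono (ball_diff_wall_subset_originComponent hh htd)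
    (mem_closure_ball_diff_wall_of_isTotallyDisconnected htd hp)

/-! ## 2. The ζ-side reading of the crux `PointComponentInvisible` -/

/-- **Point-component form of the dichotomy** (`h > 0`, the ζ-side reading of the crux
`PointComponentInvisible`): under `CEIL(h)`, no aliased far zero is at the same time a point-component
of `T_h ∩ 𝔻` and adherent to `Ω₀(h)`. -/
theorem not_pointComponent_adherent_of_latticeCeiling {h : ℝ} (hh : 0 < h) (hceil : LatticeCeiling h)
    {p : ℂ} (hp : p ∈ aliasedPoleSet h)
    (hcomp : connectedComponentIn (closure (aliasedPoleSet h) ∩ ball (0 : ℂ) 1) p ⊆ {p}) :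
    p ∉ closure (originComponent h) := fun hadh ↦ by
  have hem := aliasedPoleSet_eq_empty_of_latticeCeiling_of_cycleEncirclable hh hceil
    (cycleEncirclable_of_pointComponent hh.le hp hcomp hadh)
  rw [hem] at hp
  exact hp

end Summit.RiemannHypothesis.RiemannHypothesis.Theorems.Splittings.ScrewLatticeCycleGauss
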